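import Literature.NumberTheory.Automorphic.BianchiOrdinaryClassicality
import HarnessLib

/-!
# Interior eigenclasses of Bianchi groups: the degree-zero case of
# `bianchi_interiorEigenclass_isCuspidal`

Topic `NumberTheory/Automorphic`; proof file (theorems only: no definition, no named fact, no
instance) under the named fact
`Literature.NumberTheory.Automorphic.bianchi_interiorEigenclass_isCuspidal`
(`BianchiOrdinaryClassicality`: a non-zero interior Hecke eigenclass
`ξ ∈ H^q_!(X_U, Ṽ_wt(E))` of `GL₂` over an imaginary quadratic field `F` has the Hecke eigenvalues
of a cuspidal automorphic representation of `GL₂(𝔸_F)` of cohomological infinity type — Harder's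
`H^•_! = H^•_cusp` for `GL₂` over an imaginary quadratic field [Harder1987, §3.1 (3.1.3)–(3.1.4)
(Borel), §3.2 Prop. 3.2.4 and (3.2.5)] with the Hecke-module decomposition of `H^•_cusp` over the
cohomological cuspidal spectrum [Harder1987, pp. 65–66] and the cohomological `(𝔤_v, K_v)`-modules
at the complex place [Harder1987, §3.5 (iii), §3.6]).  The printed proof needs the Borel–Serre /
de Rham / relative Lie algebra comparison, Borel's theorems on the square-integrable cohomology,
the discrete spectrum of `GL₂` (Gelbart–Jacquet) and the classification of cohomological
`(𝔤, K)`-modules of `GL₂(ℂ)` (Enright), a theory the tree does not have; this file proves what the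
tree's combinatorial model already decides:

* `TwistedQuotient.eq_zero_of_isInterior_zero`, `TwistedQuotient.interiorCohomology_zero_eq_bot` —
  **`H⁰_! = 0` as soon as the boundary is non-empty**: for a NON-EMPTY poset `P` of proper
  rational parabolics, a class in `H⁰(Γ, Fun(𝒢 ⧸ L, V))` restricting to zero on
  `N(P)₀ × 𝒢 ⧸ L` is zero (in degree `0` the zig-zag `IsBdryTrivialization` reads `r(z) = 0`, and
  `r(z)(x, c) = z(c)`).  This is the elementary half of "`H⁰` of a non-compact arithmetic quotient
  is Eisenstein" (constants restrict non-trivially to every boundary face)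
  [cite: Schwermer2010, §5.3] — dual to the tree's `TwistedQuotient.isInterior_of_isEmpty`
  (`H^q_! = H^q` for an EMPTY boundary, `CuspidalCohomologyGLRankOneProofs`).
* `ParallelWeight.properSubspace_nonempty` — for `n ≥ 2` the Tits building of `GL_n/F` is
  non-empty (the line `F e₀` is a proper non-zero subspace), hence
  `ParallelWeight.interiorCohomology_zero_eq_bot`: `H⁰_!(X_U, Ṽ_wt(E)) = 0` for `GL_n/F`, `n ≥ 2`,
  every field `E`, every weight and every level `U`.
* `bianchi_interiorEigenclass_isCuspidal_degree_zero` — **the fact in degree `q = 0`** (binders of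
  the fact that are used, verbatim; the hypotheses "non-zero" and "interior" are contradictory in
  degree `0`, so the conclusion holds vacuously).  Degrees `q = 1, 2` (where the cuspidal
  cohomology of Bianchi groups lives) remain the content of the named fact.
* `exists_apply_ne_zero_and_eventually_eq_of_sum_eq_id` — the linear algebra of the LAST step of
  the printed proof, in the generality in which it will be consumed (any filter, any finite
  family of "projections" `p i` with `∑ p i = id` commuting eventually with the operators): a
  non-zero simultaneous eigenvector of operators acting by scalars on each summand of an
  equivariant finite decomposition has, eventually, the eigenvalues of ONE summand on which it has
  a non-zero component — "a non-zero eigenclass in `H^•_cusp = ⊕_π H^•(𝔤, K; π_∞ ⊗ M) ⊗ π_f^{K_f}`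
  singles out a cuspidal `π`" [Harder1987, pp. 65–66] (no multiplicity one needed).

## References

* G. Harder, *Eisenstein cohomology of arithmetic groups. The case GL₂*, Invent. Math. 89 (1987)
  37–118: §3.1 (pp. 59–61, `H^•_! = Ker(r)`, (3.1.1)–(3.1.4)), §3.2 (Prop. 3.2.4, (3.2.5),
  pp. 62–66), §3.5–3.6 (pp. 70–74) (read 2026-08-16 on the open GDZ scan PPN356556735_0089; store:
  acq-04651 cite-only) [Harder1987].
* T. Berger, *Denominators of Eisenstein cohomology classes for GL₂ over imaginary quadratic
  fields*, manuscripta math. 125 (2008) 427–470, §3.1 (arXiv:math/0606531, held) [Berger2007].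
* J. Schwermer, *Geometric cycles, arithmetic groups and their cohomology*, Bull. AMS 47 (2010),
  §5.3 (interior cohomology `H_! = ker(H → H(∂))`) [Schwermer2010].
* M. H. Şengün, *Arithmetic aspects of Bianchi groups* (2014), §3 (`H^i_cusp := ker resⁱ` for
  Bianchi groups), arXiv:1204.6697 (held) [Sengun2014].
-/

noncomputable section

open CategoryTheory
open scoped Classical NumberField
open NumberField IsDedekindDomain

universe u

namespace Literature.NumberTheory.Automorphic

/-! ### `H⁰_! = 0` for a non-empty boundary -/

namespace TwistedQuotient

open groupCohomology

variable {k : Type u} [CommRing k] {Γ 𝒢 : Type u} [Group Γ] [Group 𝒢]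
variable (ι : Γ →* 𝒢) (L : Subgroup 𝒢) {V : Type u} [AddCommGroup V] [Module k V]
  (ρ : Representation k Γ V) (P : Type u) [Preorder P] [MulAction Γ P]
  (hP : ∀ γ : Γ, Monotone fun x : P => γ • x)

/-- **Interior classes of degree `0` vanish when the boundary is non-empty.**  If the poset `P`
of proper rational parabolics is non-empty, a class `x ∈ H⁰(Γ, Fun(𝒢 ⧸ L, V))` admitting a
zig-zag (`IsInterior … 0 x`) is zero: in degree `0` the zig-zag condition `start` reads
`0 = r(z)` (the differential `d : C^{0-1} → C⁰` of the boundary cochain complex is zero by shape),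
and `r(z)(x₀, c) = z(c)` for any vertex `x₀ ∈ P`. [cite: Schwermer2010, §5.3] -/
theorem eq_zero_of_isInterior_zero [Nonempty P] {x : cohomology ι L ρ 0}
    (hx : IsInterior ι L ρ P hP 0 x) : x = 0 := by
  obtain ⟨z, rfl, h, t⟩ := hx
  obtain ⟨p₀⟩ := ‹Nonempty P›
  have hstart := t.start
  have hd : (inhomogeneousCochains (bdryRep ι L ρ P hP 0)).d (0 - 1) 0 = 0 :=
    (inhomogeneousCochains (bdryRep ι L ρ P hP 0)).shape _ _ (by simp)
  rw [hd] at hstart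
  have hz : iCocycles (coeffRep ι L ρ) 0 z = 0 := by
    refine inhomogeneousCochains.ext fun g => funext fun c => ?_
    have e := congrFun (congrFun hstart g)
      ((OrderHom.const (Fin (0 + 1)) p₀ : Fin (0 + 1) →o P), c)
    -- `e : 0 = r(z) g (x₀, c) = z g c`
    exact e.symm
  have hz0 : z = 0 :=
    (ModuleCat.mono_iff_injective (iCocycles (coeffRep ι L ρ) 0)).1 inferInstance
      (hz.trans (map_zero _).symm)
  rw [hz0, map_zero]

/-- **`H⁰_!(S_L, Ṽ) = 0` for a non-empty boundary** (submodule form of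
`eq_zero_of_isInterior_zero`). [cite: Schwermer2010, §5.3] -/
theorem interiorCohomology_zero_eq_bot [Nonempty P] : interiorCohomology ι L ρ P hP 0 = ⊥ :=
  (Submodule.eq_bot_iff _).2 fun _ hx => eq_zero_of_isInterior_zero ι L ρ P hP hx

end TwistedQuotient

/-! ### The Tits building of `GL_n/F` is non-empty for `n ≥ 2` -/

namespace ParallelWeight

variable (F : Type) [Field F] (n : ℕ)

/-- For `n ≥ 2` the line spanned by the first basis vector is a proper non-zero subspace of `Fⁿ`,
so the poset of proper rational parabolics of `GL_n/F` is non-empty. [folklore] -/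
theorem properSubspace_nonempty (hn : 2 ≤ n) : Nonempty (ProperSubspace F n) := by
  have h0 : 0 < n := by omega
  have h1 : 1 < n := by omega
  refine ⟨⟨Submodule.span F {Pi.single (⟨0, h0⟩ : Fin n) (1 : F)}, ?_, ?_⟩⟩
  · rw [Ne, Submodule.span_singleton_eq_bot]
    intro h
    have := congrFun h ⟨0, h0⟩
    simp at this
  · intro h
    have hmem : (Pi.single (⟨1, h1⟩ : Fin n) (1 : F) : Fin n → F) ∈
        Submodule.span F {Pi.single (⟨0, h0⟩ : Fin n) (1 : F)} := by
      rw [h]; exact Submodule.mem_top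
    obtain ⟨a, ha⟩ := Submodule.mem_span_singleton.1 hmem
    have e := congrFun ha ⟨1, h1⟩
    have hne : (⟨1, h1⟩ : Fin n) ≠ ⟨0, h0⟩ := by simp [Fin.ext_iff]
    simp [hne] at e

variable (E : Type) [Field E] [NumberField F] (wt : Fin n → ℤ)
  (U : Subgroup (BigHeckeGLn.FiniteAdelicGL n F))

/-- **`H⁰_!(X_U, Ṽ_wt(E)) = 0` for `GL_n` over a number field `F`, `n ≥ 2`** (every field `E`,
weight `wt`, level `U`): the Tits building is non-empty and degree-`0` classes restricting to zero
on it vanish. [cite: Schwermer2010, §5.3] -/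
theorem interiorCohomology_zero_eq_bot (hn : 2 ≤ n) : interiorCohomology E F n wt U 0 = ⊥ := by
  haveI := properSubspace_nonempty F n hn
  exact TwistedQuotient.interiorCohomology_zero_eq_bot _ _ _ _ _

end ParallelWeight

/-! ### The named fact in degree zero -/

open BigHeckeGLn

/-- **`bianchi_interiorEigenclass_isCuspidal` in degree `q = 0`.**  A non-zero interior class of
degree `0` does not exist (`ParallelWeight.interiorCohomology_zero_eq_bot`: `H⁰_! = 0`, the
building of `GL₂/F` being non-empty), so the conclusion of the fact — a cuspidal automorphic
representation of `GL₂(𝔸_F)` of infinity type `cohomologicalInfinityType 2 F wt^∨` with the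
prescribed Satake–Tamagawa eigenvalues at almost all places — holds vacuously; the binders are
those of the fact with `q := 0` (the ones not needed for the contradiction are omitted).  The
content of the fact is in degrees `1` and `2` [cite: Harder1987, §3.2 (3.2.5) and §3.6]. -/
theorem bianchi_interiorEigenclass_isCuspidal_degree_zero (F : Type) [Field F] [NumberField F]
    (hcpt : isCompact_glFiniteIntegralLevel 2 F) (E : Type) [Field E] (ι : E ≃+* ℂ)
    (wt : Fin 2 → ℤ) (U : Subgroup (FiniteAdelicGL 2 F))
    (ξ : ParallelWeight.cohomology E F 2 wt U 0)
    (hξ : ξ ∈ ParallelWeight.interiorCohomology E F 2 wt U 0) (hξ0 : ξ ≠ 0)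
    (a : HeightOneSpectrum (𝓞 F) → ℕ → E) :
    ∃ π₀ : CuspidalAutomorphicRepData 2 F hcpt,
      π₀.1.HasInfinityType
          (Literature.Barriers.Langlands.cohomologicalInfinityType 2 F
            (Literature.NumberTheory.DiophantineGeometry.Weight.dual wt)) ∧
      ∀ᶠ w in Filter.cofinite, ∃ α : Multiset ℂ, π₀.1.HasSatakeParamAt w α ∧
        ι (a w 1) = ((Real.sqrt (w.residueCard : ℝ) : ℝ) : ℂ) * α.esymm 1 ∧ ι (a w 2) = α.esymm 2 := by
  refine absurd ?_ hξ0
  have h := ParallelWeight.interiorCohomology_zero_eq_bot F 2 E wt U le_rfl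
  rw [h] at hξ
  exact (Submodule.mem_bot E).1 hξ

/-! ### Glue for the last step of the printed proof: an eigenclass singles out one summand -/

section Glue

open Filter

/-- **An eigenvector of an equivariant finite decomposition has, eventually, the eigenvalues of one
summand.**  Let `p i` (`i` in a finite type) be endomorphisms of `M` with `∑ i, p i = id`
(e.g. the projections of a direct-sum decomposition), let `T w j` be operators which, eventually
along a filter `l` in `w`, commute with every `p i` and act on the range of `p i` by the scalars
`χ i w j`.  If `ξ ≠ 0` is, eventually along `l`, a simultaneous eigenvector of the `T w j` with
eigenvalues `a w j`, then for some `i` with `p i ξ ≠ 0` one has `a w j = χ i w j` eventually along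
`l`.  (The last step of the printed proof: a non-zero Hecke eigenclass in
`H^•_cusp = ⊕_π H^•(𝔤, K; π_∞ ⊗ M) ⊗ π_f^{K_f}` singles out one cuspidal `π`, whose unramified
Hecke eigenvalues it carries at almost all places.) [cite: Harder1987, §3.2 pp. 65–66] -/
theorem exists_apply_ne_zero_and_eventually_eq_of_sum_eq_id {E M ι W J : Type*} [Field E]
    [AddCommGroup M] [Module E M] [Fintype ι] (p : ι → M →ₗ[E] M)
    (hp : ∑ i, p i = LinearMap.id) (T : W → J → M →ₗ[E] M) (χ : ι → W → J → E) (l : Filter W)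
    (hcomm : ∀ i, ∀ᶠ w in l, ∀ j, p i ∘ₗ T w j = T w j ∘ₗ p i)
    (hχ : ∀ i, ∀ᶠ w in l, ∀ j (m : M), T w j (p i m) = χ i w j • p i m)
    {ξ : M} (hξ : ξ ≠ 0) {a : W → J → E} (ha : ∀ᶠ w in l, ∀ j, T w j ξ = a w j • ξ) :
    ∃ i, p i ξ ≠ 0 ∧ ∀ᶠ w in l, ∀ j, a w j = χ i w j := by
  -- some component of `ξ` is non-zero, since the components sum to `ξ`
  have hsum : ∑ i, p i ξ = ξ := by
    have h := LinearMap.congr_fun hp ξ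
    rwa [LinearMap.sum_apply] at h
  obtain ⟨i, hi⟩ : ∃ i, p i ξ ≠ 0 := by
    by_contra h
    push Not at h
    exact hξ (by rw [← hsum]; exact Finset.sum_eq_zero fun i _ => h i)
  refine ⟨i, hi, ?_⟩
  filter_upwards [hcomm i, hχ i, ha] with w hcw hχw haw
  intro j
  -- compare the two computations of `p i (T w j ξ)`
  have h1 : p i (T w j ξ) = a w j • p i ξ := by rw [haw j, map_smul]
  have h2 : p i (T w j ξ) = χ i w j • p i ξ := by
    rw [← LinearMap.comp_apply, hcw j, LinearMap.comp_apply, hχw j]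
  have h3 : (a w j - χ i w j) • p i ξ = 0 := by rw [sub_smul, ← h1, ← h2, sub_self]
  exact sub_eq_zero.1 ((smul_eq_zero.1 h3).resolve_right hi)

end Glue

end Literature.NumberTheory.Automorphic
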